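import Mathlib
import HarnessLib
import Summits.HubbardSuperconductivity.HubbardSuperconductivity.Theorems.KLProgrammeKLRegimeEngineV8E5LinesTrivialGram

/-!
# Route `KLProgramme` — ENGINE child gen 8 (stmt-HubbardSuperconductivity-20437 `KLRegimeEngineV17F2`), SKELETON v2 class #3, PROVING side:
# the class-#3 `∃ (C,u)` with the FIRST STEPS' Gram data discharged too — a UNIFORM three-input interface (rows · smallness · law) at EVERY `n ≥ 1`
# (cell gate-hubbard-kl, seat p5 g10; assembly part 9; composes `…E5WitnessRows` §10 with `…E5LinesTrivialGram` §16 and `…E5WitnessLevels` §7)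

WHY.  `exists_e5Pkg2_of_stepDataRows` (…E5WitnessRows, p573937) reads, for the steps `n ≥ 3`, only (L1) the row/column sums of the rescaled dressed
derivative line, (SM) the dressing smallness and (RA-U) the carrier's U-keyed levelled law — but for the first steps `n ≤ 2` it still asks the RAW
trivial-family tuple `h12` (Gram half-norms `κ₀, κ₁`, soft-line entries `δ`, the vertex package `Nf, Ne, x′, A` and its envelope).  With the
sectorless Gram data of …E5LinesTrivialGram (`gram_klE5Lines_trivial`: `κ₀² = 9152·256·Λ_{n−1}`, `κ₁² = δ = 9152·8·Λ_{n−1}`, any admissible frame)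
and the vertex package `klE5_vertexPackage_of_levelLaw` read at level `0` units (flat law, no gain: one sector), `h12` reduces to the SAME three inputs
as `h3`: rows `α` through the trivial multiplier, the smallness, and a flat U-keyed law of the carrier in the trivial family («(RA-U)₀», the scale-0/1
twin of (RA-U)).  The extra coupling threshold is n-free: `u₁ = 1/(151008·Θ·max(Klam,1))` (`κ₀² + κ₁² ≤ 9152·264/32 = 75504`).

* §17 **`exists_e5Pkg2_of_rows`** / **`e5ShareStep2_klE5Raise2_of_rows`** — the class-#3 `∃ e, IsE5Pkg2 e ∧ E5ShareStep2 P R e.1 e.2` and the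
  step for the deferred pair from: `P.WF`, `R.WF2`, `0 ≤ Cα`, `0 ≤ C₀`, `1 ≤ Θ`, `C₀²Θ⁵/8 ≤ CA`; `h3` VERBATIM as in p573937 (steps `n ≥ 3`:
  (L1) + (SM) + (RA-U)); and `h12r` (steps `n ≤ 2`): (L1)₀ rows/columns of the rescaled dressed derivative line through `trivialMultiplier` with
  `α ≤ λ·Cα·ε⁻¹·16^n/e₀²`, (SM), and (RA-U)₀ `∀ m ≥ 4 even, ∀ Ωe : Fin m → Option (SectorLeg 1), ‖carrier‖_{trivialMultiplier, Ωe} ≤ C₀·Θ^{m/2}·(Klam U)^{m/2−1}`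
  (+ odd `≤ 0`).

OPEN INPUTS OF RECORD after this file (class #3, every `n ≥ 1`): (L1)/(L1)₀ the row sums `α` (p1 lineage / k3c1), (SM) the dressing smallness (same),
(RA-U)/(RA-U)₀ the U-keyed carrier law (E1 tower at `λ = B·Klam·U`, (Q-E1-RA-U); scale-0/1 data for `n ≤ 2`).  Located risk #14 «(c)-E5-EPS» is about the
CURRENCY of (RA-U) only (…E5WitnessRowsG).

Pure composition; no definitions, no named facts, nothing about the model's sizes is asserted; nothing asserts superconductivity.
-/

noncomputable section

namespace Summit.HubbardSuperconductivity.HubbardSuperconductivity.Theorems.KLRegimeSplit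

set_option linter.dupNamespace false -- summit = problem name (single-conjunct summit), D-0017

open Real Finset Literature.MathematicalPhysics.QuantumLattice Literature.Probability.LatticeModels GrassmannAlgebra Matrix
open Literature.MathematicalPhysics.QuantumLattice.FermiRG
open Summit.HubbardSuperconductivity.HubbardSuperconductivity.Theorems.KLProgrammeLegKernels
open Summit.HubbardSuperconductivity.HubbardSuperconductivity.Theorems.KLRegimeWick
open Summit.HubbardSuperconductivity.HubbardSuperconductivity.Theorems.EngineV8
open Summit.HubbardSuperconductivity.HubbardSuperconductivity.Theorems.TwoPointAssembly
open Summit.HubbardSuperconductivity.HubbardSuperconductivity.Theorems.TorusFourierL2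
open Summit.HubbardSuperconductivity.HubbardSuperconductivity.Theorems.DispersionFlow

/-! ## §17 The class-#3 `∃ (C,u)` from rows · smallness · law at EVERY step -/

section RowsAll

variable (P : SplitConsts) (R : RenConsts) {Cα C₀ Θ CA : ℝ}

/-- **The class-#3 `∃ (C,u)` from ROWS · SMALLNESS · LAW at EVERY step** — `exists_e5Pkg2_of_stepDataRows` with the first steps' (`n ≤ 2`) trivial-family
Gram half-norms, soft-line entries, vertex package, envelope and threshold ALSO discharged inside (`gram_klE5Lines_trivial` at the frame `K_n`;
`klE5_vertexPackage_of_levelLaw` at level-`0` units with Gram base `9152·264·Λ_{n−1} ≤ 75504`; threshold `u₁ = 1/(151008·Θ·max(Klam,1))`, n-free).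
Inputs: `h3` VERBATIM as in p573937; `h12r` = per step `n ≤ 2`: `α ≥ 0` with the row/column sums of the rescaled dressed derivative line through
`trivialMultiplier` and `α ≤ λ·Cα·ε⁻¹·16^n/e₀²`, the dressing smallness at `Λ_n` and `Λ`, and the flat U-keyed law of the carrier in the trivial family
(odd prescriptions `0`).  `C₀²Θ⁵/8 ≤ CA` serves both branches. [cite: BenfattoGiulianiMastropietro2006, §2.8 (2.80); Lemma 2.5 (2.98)] -/
theorem exists_e5Pkg2_of_rows (hP : P.WF) (hR : R.WF2) (hCα : 0 ≤ Cα) (hC₀ : 0 ≤ C₀) (hΘ : 1 ≤ Θ) (hCA : C₀ ^ 2 * Θ ^ 5 / 8 ≤ CA)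
    (hKlam : 0 ≤ P.Klam)
    (h3 : ∃ u : EngConsts → ℝ → ℝ, (∀ Q cc, 0 < u Q cc) ∧
        ∀ G : GeoConsts, G.WF → ∀ Q : EngConsts, (klEngQ7 P R).IsRaiseOf Q →
        ∀ cc : ℝ, 0 < cc → cc ≤ klEngC₃6 P R →
        ∀ μ ∈ klWindowC, ∀ U : ℝ, 0 < U → U ≤ klEngU₀10 P R cc → U ≤ u Q cc →
        ∀ β : ℝ, klBetaMin ≤ β → β ≤ Real.exp (cc / U ^ 2) →
        ∀ (L M : ℕ) [NeZero L] [NeZero M], klEngL₄ P R β U ≤ L → klEngM₃ β U L ≤ M →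
        ∀ n : ℕ, 1 ≤ n → n ≤ nScales β + 1 → IsKLRegime U cc (-(n : ℤ)) →
        HistP klPredsV17F2 L M G P Q R β U μ 0 n →
        FrameOK R U (nScales β) μ (klFlowFrameU L M β U μ n) →
        (∀ j ≤ n, LevelsUExportMixedAt L M (klCU2 P R (klEngQ7 P R)) P β U μ j) →
        ∀ Λ ∈ Set.Icc (klScale klE0 n) (klScale klE0 (n - 1)), ∀ Qm : TorusSite 2 L,
        ∀ x y : TorusSite 2 L × MatsubaraIdx M, x.1 ∈ klBall L μ 0 → y.1 ∈ klBall L μ 0 →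
        3 ≤ n →
        ∃ α : ℝ, 0 ≤ α ∧
          (∀ X, ∑ Y, ‖((sectorSubMatrix L M β (bgmFatMultiplier L M klE0 β (nambuXiCT L μ (klFlowFrameU L M β U μ n)) (n - 2))).transpose *
            normalCovariance L M (fun ks => ((klScale klE0 (n - 1) - klScale klE0 n : ℝ) : ℂ) * klE5DerivLineSym L M β μ (klFlowFrameU L M β U μ n) (n - 1) (klE5Kappa L M β U μ (klFlowFrameU L M β U μ n) (n - 1)) Λ ks) *
            sectorSubMatrix L M β (bgmFatMultiplier L M klE0 β (nambuXiCT L μ (klFlowFrameU L M β U μ n)) (n - 2))) X Y‖ ≤ α) ∧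
          (∀ Y, ∑ X, ‖((sectorSubMatrix L M β (bgmFatMultiplier L M klE0 β (nambuXiCT L μ (klFlowFrameU L M β U μ n)) (n - 2))).transpose *
            normalCovariance L M (fun ks => ((klScale klE0 (n - 1) - klScale klE0 n : ℝ) : ℂ) * klE5DerivLineSym L M β μ (klFlowFrameU L M β U μ n) (n - 1) (klE5Kappa L M β U μ (klFlowFrameU L M β U μ n) (n - 1)) Λ ks) *
            sectorSubMatrix L M β (bgmFatMultiplier L M klE0 β (nambuXiCT L μ (klFlowFrameU L M β U μ n)) (n - 2))) X Y‖ ≤ α) ∧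
          (∀ ks : FreqMomentum L M × Fin 2, ‖klE5SliceSym L M β μ (klFlowFrameU L M β U μ n) (n - 1) (klScale klE0 n) ks * (klE5Kappa L M β U μ (klFlowFrameU L M β U μ n) (n - 1)) ks‖ ≤ 1 / 2 ∧
            ‖klE5SliceSym L M β μ (klFlowFrameU L M β U μ n) (n - 1) Λ ks * (klE5Kappa L M β U μ (klFlowFrameU L M β U μ n) (n - 1)) ks‖ ≤ 1 / 2) ∧
          (∀ m : ℕ, 4 ≤ m → Even m → ∀ Ωe : Fin m → Option (SectorLeg (sectorCount (n - 2) + 4)),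
            hubbardSectorKernelNorm L M β (pointAugment (klAnisoFamily L M β μ (klFlowFrameU L M β U μ n) klE0 (n - 2)) (klE5ExtMomenta Qm x y)) (prescribedTuples univ Ωe) (klE5Carrier L M β μ (klFlowFrameU L M β U μ n) (n - 1) (klE5Kappa L M β U μ (klFlowFrameU L M β U μ n) (n - 1)) (klE5Input L M β U μ (klFlowFrameU L M β U μ n) (n - 1)) Λ) ≤
              C₀ * Θ ^ (m / 2) * (P.Klam * U) ^ (m / 2 - 1) * (2 : ℝ) ^ ((3 * (m / 2) - 5) * (n - 2)) *
                (((2 : ℝ) ^ (n - 2))⁻¹) ^ levelGainExp (levelCount Ωe)) ∧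
          (∀ m : ℕ, ¬ Even m → ∀ Ωe : Fin m → Option (SectorLeg (sectorCount (n - 2) + 4)),
            hubbardSectorKernelNorm L M β (pointAugment (klAnisoFamily L M β μ (klFlowFrameU L M β U μ n) klE0 (n - 2)) (klE5ExtMomenta Qm x y)) (prescribedTuples univ Ωe) (klE5Carrier L M β μ (klFlowFrameU L M β U μ n) (n - 1) (klE5Kappa L M β U μ (klFlowFrameU L M β U μ n) (n - 1)) (klE5Input L M β U μ (klFlowFrameU L M β U μ n) (n - 1)) Λ) ≤ 0) ∧
          α ≤ (klScale klE0 (n - 1) - klScale klE0 n) * (Cα * (imagTimeWeight β M)⁻¹ * (16 : ℝ) ^ n / klE0 ^ 2))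
    (h12r : ∃ u : EngConsts → ℝ → ℝ, (∀ Q cc, 0 < u Q cc) ∧
        ∀ G : GeoConsts, G.WF → ∀ Q : EngConsts, (klEngQ7 P R).IsRaiseOf Q →
        ∀ cc : ℝ, 0 < cc → cc ≤ klEngC₃6 P R →
        ∀ μ ∈ klWindowC, ∀ U : ℝ, 0 < U → U ≤ klEngU₀10 P R cc → U ≤ u Q cc →
        ∀ β : ℝ, klBetaMin ≤ β → β ≤ Real.exp (cc / U ^ 2) →
        ∀ (L M : ℕ) [NeZero L] [NeZero M], klEngL₄ P R β U ≤ L → klEngM₃ β U L ≤ M →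
        ∀ n : ℕ, 1 ≤ n → n ≤ nScales β + 1 → IsKLRegime U cc (-(n : ℤ)) →
        HistP klPredsV17F2 L M G P Q R β U μ 0 n →
        FrameOK R U (nScales β) μ (klFlowFrameU L M β U μ n) →
        (∀ j ≤ n, LevelsUExportMixedAt L M (klCU2 P R (klEngQ7 P R)) P β U μ j) →
        ∀ Λ ∈ Set.Icc (klScale klE0 n) (klScale klE0 (n - 1)), ∀ Qm : TorusSite 2 L,
        ∀ x y : TorusSite 2 L × MatsubaraIdx M, x.1 ∈ klBall L μ 0 → y.1 ∈ klBall L μ 0 →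
        n ≤ 2 →
        ∃ α : ℝ, 0 ≤ α ∧
          (∀ X, ∑ Y, ‖((sectorSubMatrix L M β (trivialMultiplier L M)).transpose *
            normalCovariance L M (fun ks => ((klScale klE0 (n - 1) - klScale klE0 n : ℝ) : ℂ) * klE5DerivLineSym L M β μ (klFlowFrameU L M β U μ n) (n - 1) (klE5Kappa L M β U μ (klFlowFrameU L M β U μ n) (n - 1)) Λ ks) *
            sectorSubMatrix L M β (trivialMultiplier L M)) X Y‖ ≤ α) ∧
          (∀ Y, ∑ X, ‖((sectorSubMatrix L M β (trivialMultiplier L M)).transpose *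
            normalCovariance L M (fun ks => ((klScale klE0 (n - 1) - klScale klE0 n : ℝ) : ℂ) * klE5DerivLineSym L M β μ (klFlowFrameU L M β U μ n) (n - 1) (klE5Kappa L M β U μ (klFlowFrameU L M β U μ n) (n - 1)) Λ ks) *
            sectorSubMatrix L M β (trivialMultiplier L M)) X Y‖ ≤ α) ∧
          (∀ ks : FreqMomentum L M × Fin 2, ‖klE5SliceSym L M β μ (klFlowFrameU L M β U μ n) (n - 1) (klScale klE0 n) ks * (klE5Kappa L M β U μ (klFlowFrameU L M β U μ n) (n - 1)) ks‖ ≤ 1 / 2 ∧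
            ‖klE5SliceSym L M β μ (klFlowFrameU L M β U μ n) (n - 1) Λ ks * (klE5Kappa L M β U μ (klFlowFrameU L M β U μ n) (n - 1)) ks‖ ≤ 1 / 2) ∧
          (∀ m : ℕ, 4 ≤ m → Even m → ∀ Ωe : Fin m → Option (SectorLeg 1),
            hubbardSectorKernelNorm L M β (trivialMultiplier L M) (prescribedTuples univ Ωe) (klE5Carrier L M β μ (klFlowFrameU L M β U μ n) (n - 1) (klE5Kappa L M β U μ (klFlowFrameU L M β U μ n) (n - 1)) (klE5Input L M β U μ (klFlowFrameU L M β U μ n) (n - 1)) Λ) ≤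
              C₀ * Θ ^ (m / 2) * (P.Klam * U) ^ (m / 2 - 1)) ∧
          (∀ m : ℕ, ¬ Even m → ∀ Ωe : Fin m → Option (SectorLeg 1),
            hubbardSectorKernelNorm L M β (trivialMultiplier L M) (prescribedTuples univ Ωe) (klE5Carrier L M β μ (klFlowFrameU L M β U μ n) (n - 1) (klE5Kappa L M β U μ (klFlowFrameU L M β U μ n) (n - 1)) (klE5Input L M β U μ (klFlowFrameU L M β U μ n) (n - 1)) Λ) ≤ 0) ∧
          α ≤ (klScale klE0 (n - 1) - klScale klE0 n) * (Cα * (imagTimeWeight β M)⁻¹ * (16 : ℝ) ^ n / klE0 ^ 2)) :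
    ∃ e : ℝ × (EngConsts → ℝ → ℝ), IsE5Pkg2 e ∧ E5ShareStep2 P R e.1 e.2 := by
  obtain ⟨u12, hu12, h12⟩ := h12r
  have he₀ : (0 : ℝ) < klE0 := by norm_num [klE0]
  have hΘ0 : 0 < Θ := zero_lt_one.trans_le hΘ
  have hmax : 0 < max P.Klam 1 := lt_max_of_lt_right one_pos
  have hCA0 : 0 ≤ CA := le_trans (by positivity) hCA
  have hCA64 : C₀ ^ 2 * Θ ^ 5 / 64 ≤ CA := by
    have h0 : 0 ≤ C₀ ^ 2 * Θ ^ 5 := by positivity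
    linarith
  -- the n-free threshold closing the first steps' envelope
  set u₁ : ℝ := 1 / (151008 * Θ * max P.Klam 1) with hu₁
  have hu₁pos : 0 < u₁ := by rw [hu₁]; positivity
  refine exists_e5Pkg2_of_stepDataRows P R (Cδ := 1171456) hP hR hCα hC₀ hΘ hCA64 hKlam h3 ⟨fun Q cc => min (u12 Q cc) u₁,
    fun Q cc => lt_min (hu12 Q cc) hu₁pos, ?_⟩
  intro G hG Q hQ cc hcc hcc3 μ hμ U hU hU10 hUu β hβ hβc L M _ _ hL hM n hn hnN hreg hH hF hX Λ hΛ Qm x y hx hy h2n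
  have hUu12 : U ≤ u12 Q cc := hUu.trans (min_le_left _ _)
  have hUu₁ : U ≤ u₁ := hUu.trans (min_le_right _ _)
  obtain ⟨α, hα, hrow, hcol, hsm, hlaw, hodd, hαs⟩ :=
    h12 G hG Q hQ cc hcc hcc3 μ hμ U hU hU10 hUu12 β hβ hβc L M hL hM n hn hnN hreg hH hF hX Λ hΛ Qm x y hx hy h2n
  -- the trivial-family line data at the frame `K_n`
  have hL2 : β ^ 2 ≤ (L : ℝ) := sq_le_of_klEngL₃_le ((klEngL₃_le_klEngL₄ P R β U).trans hL)
  obtain ⟨hκF₀, hκG₀, hent, hκF₁, hκG₁⟩ := gram_klE5Lines_trivial (L := L) (M := M)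
    (klE5Kappa L M β U μ (klFlowFrameU L M β U μ n) (n - 1)) hF hβ hL2 hn hΛ hsm
  -- sizes of the scales at the first steps
  have hΛtop : 0 < klScale klE0 (n - 1) := by unfold klScale; positivity
  have hΛtop32 : klScale klE0 (n - 1) ≤ 1 / 32 := by
    unfold klScale klE0
    have : (1 : ℝ) ≤ 4 ^ (n - 1) := one_le_pow₀ (by norm_num)
    exact mul_le_of_le_one_right (by norm_num) (inv_le_one_of_one_le₀ this)
  -- the vertex package at level-0 units, Gram base `κs = 9152·264·Λ_{n−1}`
  set κs : ℝ := 9152 * 264 * klScale klE0 (n - 1) with hκs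
  have hκs0 : 0 ≤ κs := by rw [hκs]; positivity
  have hκs_le : κs ≤ 75504 := by
    rw [hκs]
    calc (9152 : ℝ) * 264 * klScale klE0 (n - 1) ≤ 9152 * 264 * (1 / 32) := by gcongr
      _ = 75504 := by norm_num
  have hg : 0 ≤ P.Klam * U := mul_nonneg hKlam hU.le
  have hsmall : κs * Θ * (P.Klam * U) * (8 : ℝ) ^ (2 - 2) ≤ 1 / 2 := by
    rw [show (8 : ℝ) ^ (2 - 2) = 1 by norm_num, mul_one]
    have hKU : P.Klam * U ≤ max P.Klam 1 * u₁ := mul_le_mul (le_max_left _ _) hUu₁ hU.le hmax.le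
    have h2 : 75504 * Θ * (max P.Klam 1 * u₁) = 1 / 2 := by
      rw [hu₁]; field_simp; norm_num
    calc κs * Θ * (P.Klam * U) ≤ 75504 * Θ * (max P.Klam 1 * u₁) := by gcongr
      _ = 1 / 2 := h2
  have hlaw' : ∀ m : ℕ, 4 ≤ m → Even m → ∀ Ωe : Fin m → Option (SectorLeg 1),
      hubbardSectorKernelNorm L M β (trivialMultiplier L M) (prescribedTuples univ Ωe)
        (klE5Carrier L M β μ (klFlowFrameU L M β U μ n) (n - 1) (klE5Kappa L M β U μ (klFlowFrameU L M β U μ n) (n - 1))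
          (klE5Input L M β U μ (klFlowFrameU L M β U μ n) (n - 1)) Λ) ≤
        C₀ * Θ ^ (m / 2) * (P.Klam * U) ^ (m / 2 - 1) * (2 : ℝ) ^ ((3 * (m / 2) - 5) * (2 - 2)) *
          (((2 : ℝ) ^ (2 - 2))⁻¹) ^ levelGainExp (levelCount Ωe) := by
    intro m hm he Ωe
    have e1 : (2 : ℝ) ^ ((3 * (m / 2) - 5) * (2 - 2)) = 1 := by rw [Nat.sub_self, mul_zero, pow_zero]
    have e2 : (((2 : ℝ) ^ (2 - 2))⁻¹) ^ levelGainExp (levelCount Ωe) = 1 := by rw [Nat.sub_self, pow_zero, inv_one, one_pow]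
    rw [e1, e2, mul_one, mul_one]
    exact hlaw m hm he Ωe
  obtain ⟨Nf, Ne, x', A, hNe0, hNf, hNe, hx0, hx1, hA, henv, hAs⟩ :=
    klE5_vertexPackage_of_levelLaw β (trivialMultiplier L M)
      (klE5Carrier L M β μ (klFlowFrameU L M β U μ n) (n - 1) (klE5Kappa L M β U μ (klFlowFrameU L M β U μ n) (n - 1))
        (klE5Input L M β U μ (klFlowFrameU L M β U μ n) (n - 1)) Λ) (n := 2) le_rfl hg hC₀ hΘ hκs0 hlaw' hodd hsmall
  -- the Gram base of the envelope is `κ₀² + κ₁² = κs`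
  have hbase : Real.sqrt (9152 * 256 * klScale klE0 (n - 1)) ^ 2 + Real.sqrt (9152 * 8 * klScale klE0 (n - 1)) ^ 2 = κs := by
    rw [Real.sq_sqrt (by positivity), Real.sq_sqrt (by positivity), hκs]; ring
  refine ⟨α, Real.sqrt (9152 * 256 * klScale klE0 (n - 1)), 9152 * 8 * klScale klE0 (n - 1), Real.sqrt (9152 * 8 * klScale klE0 (n - 1)),
    x', A, Nf, Ne, hα, Real.sqrt_nonneg _, by positivity, Real.sqrt_nonneg _, hrow, hcol, fun Y _ => hκF₀ Y, fun Y _ => hκG₀ Y, hent,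
    fun Y _ => hκF₁ Y, fun Y _ => hκG₁ Y, hNe0, hNf, hNe, hx0, hx1, hA, ?_, hαs, ?_, hAs.trans ?_⟩
  · intro q hq k hk
    rw [hbase]
    exact henv q hq k hk
  · -- `9152·8·Λ_{n−1} ≤ 1171456·e₀·8^{−n}` for `1 ≤ n ≤ 2` (`Λ_{n−1} = e₀·4^{−(n−1)}`, `8^n ≤ 4·2^n·4^{n−1}`)
    interval_cases n
    · norm_num [klScale, klE0]
    · norm_num [klScale, klE0]
  · -- `(C₀²Θ⁵/64)·ε²·(Klam U)³·8² ≤ CA·ε²·(Klam U)³·8^n` for `1 ≤ n`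
    have h8 : (8 : ℝ) ≤ (8 : ℝ) ^ n := by
      calc (8 : ℝ) = 8 ^ 1 := (pow_one _).symm
        _ ≤ 8 ^ n := pow_le_pow_right₀ (by norm_num) hn
    have h1 : C₀ ^ 2 * Θ ^ 5 / 64 * imagTimeWeight β M ^ 2 * (P.Klam * U) ^ 3 * (8 : ℝ) ^ 2 =
        (C₀ ^ 2 * Θ ^ 5 / 8) * imagTimeWeight β M ^ 2 * (P.Klam * U) ^ 3 * 8 := by ring
    rw [h1]
    exact mul_le_mul (mul_le_mul_of_nonneg_right (mul_le_mul_of_nonneg_right hCA (sq_nonneg _)) (pow_nonneg hg 3)) h8 (by norm_num)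
      (by positivity)

/-- **Hence the successor step for the DEFERRED pair** from rows · smallness · law at every step. [cite: BenfattoGiulianiMastropietro2006, §2.8 (2.80)] -/
theorem e5ShareStep2_klE5Raise2_of_rows (hP : P.WF) (hR : R.WF2) (hCα : 0 ≤ Cα) (hC₀ : 0 ≤ C₀) (hΘ : 1 ≤ Θ) (hCA : C₀ ^ 2 * Θ ^ 5 / 8 ≤ CA)
    (hKlam : 0 ≤ P.Klam)
    (h3 : ∃ u : EngConsts → ℝ → ℝ, (∀ Q cc, 0 < u Q cc) ∧
        ∀ G : GeoConsts, G.WF → ∀ Q : EngConsts, (klEngQ7 P R).IsRaiseOf Q →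
        ∀ cc : ℝ, 0 < cc → cc ≤ klEngC₃6 P R →
        ∀ μ ∈ klWindowC, ∀ U : ℝ, 0 < U → U ≤ klEngU₀10 P R cc → U ≤ u Q cc →
        ∀ β : ℝ, klBetaMin ≤ β → β ≤ Real.exp (cc / U ^ 2) →
        ∀ (L M : ℕ) [NeZero L] [NeZero M], klEngL₄ P R β U ≤ L → klEngM₃ β U L ≤ M →
        ∀ n : ℕ, 1 ≤ n → n ≤ nScales β + 1 → IsKLRegime U cc (-(n : ℤ)) →
        HistP klPredsV17F2 L M G P Q R β U μ 0 n →
        FrameOK R U (nScales β) μ (klFlowFrameU L M β U μ n) →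
        (∀ j ≤ n, LevelsUExportMixedAt L M (klCU2 P R (klEngQ7 P R)) P β U μ j) →
        ∀ Λ ∈ Set.Icc (klScale klE0 n) (klScale klE0 (n - 1)), ∀ Qm : TorusSite 2 L,
        ∀ x y : TorusSite 2 L × MatsubaraIdx M, x.1 ∈ klBall L μ 0 → y.1 ∈ klBall L μ 0 →
        3 ≤ n →
        ∃ α : ℝ, 0 ≤ α ∧
          (∀ X, ∑ Y, ‖((sectorSubMatrix L M β (bgmFatMultiplier L M klE0 β (nambuXiCT L μ (klFlowFrameU L M β U μ n)) (n - 2))).transpose *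
            normalCovariance L M (fun ks => ((klScale klE0 (n - 1) - klScale klE0 n : ℝ) : ℂ) * klE5DerivLineSym L M β μ (klFlowFrameU L M β U μ n) (n - 1) (klE5Kappa L M β U μ (klFlowFrameU L M β U μ n) (n - 1)) Λ ks) *
            sectorSubMatrix L M β (bgmFatMultiplier L M klE0 β (nambuXiCT L μ (klFlowFrameU L M β U μ n)) (n - 2))) X Y‖ ≤ α) ∧
          (∀ Y, ∑ X, ‖((sectorSubMatrix L M β (bgmFatMultiplier L M klE0 β (nambuXiCT L μ (klFlowFrameU L M β U μ n)) (n - 2))).transpose *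
            normalCovariance L M (fun ks => ((klScale klE0 (n - 1) - klScale klE0 n : ℝ) : ℂ) * klE5DerivLineSym L M β μ (klFlowFrameU L M β U μ n) (n - 1) (klE5Kappa L M β U μ (klFlowFrameU L M β U μ n) (n - 1)) Λ ks) *
            sectorSubMatrix L M β (bgmFatMultiplier L M klE0 β (nambuXiCT L μ (klFlowFrameU L M β U μ n)) (n - 2))) X Y‖ ≤ α) ∧
          (∀ ks : FreqMomentum L M × Fin 2, ‖klE5SliceSym L M β μ (klFlowFrameU L M β U μ n) (n - 1) (klScale klE0 n) ks * (klE5Kappa L M β U μ (klFlowFrameU L M β U μ n) (n - 1)) ks‖ ≤ 1 / 2 ∧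
            ‖klE5SliceSym L M β μ (klFlowFrameU L M β U μ n) (n - 1) Λ ks * (klE5Kappa L M β U μ (klFlowFrameU L M β U μ n) (n - 1)) ks‖ ≤ 1 / 2) ∧
          (∀ m : ℕ, 4 ≤ m → Even m → ∀ Ωe : Fin m → Option (SectorLeg (sectorCount (n - 2) + 4)),
            hubbardSectorKernelNorm L M β (pointAugment (klAnisoFamily L M β μ (klFlowFrameU L M β U μ n) klE0 (n - 2)) (klE5ExtMomenta Qm x y)) (prescribedTuples univ Ωe) (klE5Carrier L M β μ (klFlowFrameU L M β U μ n) (n - 1) (klE5Kappa L M β U μ (klFlowFrameU L M β U μ n) (n - 1)) (klE5Input L M β U μ (klFlowFrameU L M β U μ n) (n - 1)) Λ) ≤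
              C₀ * Θ ^ (m / 2) * (P.Klam * U) ^ (m / 2 - 1) * (2 : ℝ) ^ ((3 * (m / 2) - 5) * (n - 2)) *
                (((2 : ℝ) ^ (n - 2))⁻¹) ^ levelGainExp (levelCount Ωe)) ∧
          (∀ m : ℕ, ¬ Even m → ∀ Ωe : Fin m → Option (SectorLeg (sectorCount (n - 2) + 4)),
            hubbardSectorKernelNorm L M β (pointAugment (klAnisoFamily L M β μ (klFlowFrameU L M β U μ n) klE0 (n - 2)) (klE5ExtMomenta Qm x y)) (prescribedTuples univ Ωe) (klE5Carrier L M β μ (klFlowFrameU L M β U μ n) (n - 1) (klE5Kappa L M β U μ (klFlowFrameU L M β U μ n) (n - 1)) (klE5Input L M β U μ (klFlowFrameU L M β U μ n) (n - 1)) Λ) ≤ 0) ∧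
          α ≤ (klScale klE0 (n - 1) - klScale klE0 n) * (Cα * (imagTimeWeight β M)⁻¹ * (16 : ℝ) ^ n / klE0 ^ 2))
    (h12r : ∃ u : EngConsts → ℝ → ℝ, (∀ Q cc, 0 < u Q cc) ∧
        ∀ G : GeoConsts, G.WF → ∀ Q : EngConsts, (klEngQ7 P R).IsRaiseOf Q →
        ∀ cc : ℝ, 0 < cc → cc ≤ klEngC₃6 P R →
        ∀ μ ∈ klWindowC, ∀ U : ℝ, 0 < U → U ≤ klEngU₀10 P R cc → U ≤ u Q cc →
        ∀ β : ℝ, klBetaMin ≤ β → β ≤ Real.exp (cc / U ^ 2) →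
        ∀ (L M : ℕ) [NeZero L] [NeZero M], klEngL₄ P R β U ≤ L → klEngM₃ β U L ≤ M →
        ∀ n : ℕ, 1 ≤ n → n ≤ nScales β + 1 → IsKLRegime U cc (-(n : ℤ)) →
        HistP klPredsV17F2 L M G P Q R β U μ 0 n →
        FrameOK R U (nScales β) μ (klFlowFrameU L M β U μ n) →
        (∀ j ≤ n, LevelsUExportMixedAt L M (klCU2 P R (klEngQ7 P R)) P β U μ j) →
        ∀ Λ ∈ Set.Icc (klScale klE0 n) (klScale klE0 (n - 1)), ∀ Qm : TorusSite 2 L,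
        ∀ x y : TorusSite 2 L × MatsubaraIdx M, x.1 ∈ klBall L μ 0 → y.1 ∈ klBall L μ 0 →
        n ≤ 2 →
        ∃ α : ℝ, 0 ≤ α ∧
          (∀ X, ∑ Y, ‖((sectorSubMatrix L M β (trivialMultiplier L M)).transpose *
            normalCovariance L M (fun ks => ((klScale klE0 (n - 1) - klScale klE0 n : ℝ) : ℂ) * klE5DerivLineSym L M β μ (klFlowFrameU L M β U μ n) (n - 1) (klE5Kappa L M β U μ (klFlowFrameU L M β U μ n) (n - 1)) Λ ks) *
            sectorSubMatrix L M β (trivialMultiplier L M)) X Y‖ ≤ α) ∧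
          (∀ Y, ∑ X, ‖((sectorSubMatrix L M β (trivialMultiplier L M)).transpose *
            normalCovariance L M (fun ks => ((klScale klE0 (n - 1) - klScale klE0 n : ℝ) : ℂ) * klE5DerivLineSym L M β μ (klFlowFrameU L M β U μ n) (n - 1) (klE5Kappa L M β U μ (klFlowFrameU L M β U μ n) (n - 1)) Λ ks) *
            sectorSubMatrix L M β (trivialMultiplier L M)) X Y‖ ≤ α) ∧
          (∀ ks : FreqMomentum L M × Fin 2, ‖klE5SliceSym L M β μ (klFlowFrameU L M β U μ n) (n - 1) (klScale klE0 n) ks * (klE5Kappa L M β U μ (klFlowFrameU L M β U μ n) (n - 1)) ks‖ ≤ 1 / 2 ∧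
            ‖klE5SliceSym L M β μ (klFlowFrameU L M β U μ n) (n - 1) Λ ks * (klE5Kappa L M β U μ (klFlowFrameU L M β U μ n) (n - 1)) ks‖ ≤ 1 / 2) ∧
          (∀ m : ℕ, 4 ≤ m → Even m → ∀ Ωe : Fin m → Option (SectorLeg 1),
            hubbardSectorKernelNorm L M β (trivialMultiplier L M) (prescribedTuples univ Ωe) (klE5Carrier L M β μ (klFlowFrameU L M β U μ n) (n - 1) (klE5Kappa L M β U μ (klFlowFrameU L M β U μ n) (n - 1)) (klE5Input L M β U μ (klFlowFrameU L M β U μ n) (n - 1)) Λ) ≤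
              C₀ * Θ ^ (m / 2) * (P.Klam * U) ^ (m / 2 - 1)) ∧
          (∀ m : ℕ, ¬ Even m → ∀ Ωe : Fin m → Option (SectorLeg 1),
            hubbardSectorKernelNorm L M β (trivialMultiplier L M) (prescribedTuples univ Ωe) (klE5Carrier L M β μ (klFlowFrameU L M β U μ n) (n - 1) (klE5Kappa L M β U μ (klFlowFrameU L M β U μ n) (n - 1)) (klE5Input L M β U μ (klFlowFrameU L M β U μ n) (n - 1)) Λ) ≤ 0) ∧
          α ≤ (klScale klE0 (n - 1) - klScale klE0 n) * (Cα * (imagTimeWeight β M)⁻¹ * (16 : ℝ) ^ n / klE0 ^ 2)) :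
    E5ShareStep2 P R (klE5Raise2 P R) (klE5ShareU2 P R) :=
  e5ShareStep2_klE5Raise2_of_exists (exists_e5Pkg2_of_rows P R hP hR hCα hC₀ hΘ hCA hKlam h3 h12r)

end RowsAll

end Summit.HubbardSuperconductivity.HubbardSuperconductivity.Theorems.KLRegimeSplit

end
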